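import Summits.ResolutionOfSingularities.ResolutionOfSingularities.Theorems.WildConesCampaignW46AtomChartOrder
import HarnessLib

/-!
# [OURS · L1 W4.6, rung (i) — the dictionary, SCHEME HALF, brick 28] The `z`-residue of a point of the transform:
# over an atom of order `≥ p + 1`, every point of the transform in a `u`-chart has `z/uᵢ ≡ 0`

Cell res-hironaka (LADDER-RESOLUTION rung L, D-0089), slot W4.6 «restricted regimes as rungs», seat res-L1-s46-pv-2
(gen 5: the GEOMETRIC upgrade of the forced-atom rung — finitely many singular points instead of one). Host: route
`WildCones`, crux `ClassicalRegimes` (stmt-ResolutionOfSingularities-16884), `--supports … --as helper`.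

HONEST FRAMING. Everything here is OURS: a computation with this seat's formal-chart recognition (brick 5,
`FormalChart.exists_ringEquiv_completion_chart`) in the ring-level setting of bricks 8/9 (`…AtomChart`,
`…AtomChartOrder`). NOTHING here is a statement of H. Hironaka's manuscript [Hironaka2017] and nothing of it is used;
no FACT-LIST premise. AI review is weaker than expert review.

## What is proved (`tau_none_mem_maximalIdeal_of_transform_mem`)

Ring-level setting of brick 9's `z`-chart lemma, now in a `u`-CHART `some i₀`: `g : R → L` a local map of Noetherian
local rings, `E₀ : R̂ ≅ κ⟦z, u₁, …, uₙ⟧` with an adapted system `c` (`E₀ c_j ≡ X_j mod 𝔪²`, `(c) = 𝔪_R`), chart data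
`g c_j = g cᵢ · e_j`, `𝔪_L = (g cᵢ) + (e_j − g τ̃_j : j ≠ i₀)`, `L` rational over `R`, `dim L ≥ n + 1`; an atom
presentation `E₀ f₀ = w₀ · (z^p − a)` with `a = ser c₀` of ORDER `≥ p + 1`; and the transform `f′` with
`g f₀ = (g cᵢ)^p · f′`. **If `f′ ∈ 𝔪_L` (the point lies on the transform), then `τ̃_none ∈ 𝔪_R`**: the `z`-coordinate
`z/uᵢ` of the point VANISHES. Reason: through the chart `z ↦ uᵢ (z + ζ)`, `u_j ↦ uᵢ (u_j + t_j)` the atom becomes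
`uᵢ^p · unit · ((z + ζ)^p − uᵢ · m)` because `ord a ≥ p + 1`; so the constant term of (a unit times) `E f′` is `ζ^p`,
and `f′ ∈ 𝔪` forces `ζ^p = 0`, i.e. `ζ = 0`, where `ζ` is the residue of `τ̃_none`.

ROLE. With brick 27 (`ChartPoint.eq_of_chartData_congr`: a point over `ξ` is determined by its chart index and ALL its
residues) this shows that a SINGULAR point of the transform over an atom point of order `≥ p + 1` is determined by its
chart index and its `u`-residues `t_j` alone — the data the `WildCones` calculus sees (`step i₀ t`); the finite-`Sing`
forced-atom rung (this seat, gen 5) counts singular points this way. References: H. Matsumura, *Commutative Ring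
Theory* (1986), Thm. 8.11 [Matsumura1987] (completions, as in bricks 5/9); H. Hironaka, ms. 2017, Th. 16.6 p.84 —
ROLE of «the closed points `ξ′ ∈ π⁻¹(ξ)` at which the transform has order `≥ b`» only, under adjudication, not cited
as fact. [folklore]
-/

noncomputable section

-- single-problem summit: the doubled namespace component `ResolutionOfSingularities` is forced
set_option linter.dupNamespace false

open scoped BigOperators Classical
open MvPowerSeries IsLocalRing

namespace Summit.ResolutionOfSingularities.ResolutionOfSingularities.Theorems

namespace CampaignW46.AtomGerm

open WildCones
open CampaignW46.FormalDictionary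
open CampaignW46.FormalChart
open Literature.AlgebraicGeometry.Resolution
open Literature.RingTheory.MvPowerSeries.Jets (mem_maximalIdeal_iff_constantCoeff_eq_zero)

variable {n : ℕ} {κ : Type} [Field κ] {p : ℕ}

/-! ## The `z`-residue of a point of the transform in a `u`-chart -/

section UChart

variable [Fact p.Prime] [CharP κ p]
  {R : Type} [CommRing R] [IsLocalRing R] [IsNoetherianRing R]
  {L : Type} [CommRing L] [IsLocalRing L] [IsNoetherianRing L]
  (g : R →+* L) (hg : (maximalIdeal R).map g ≤ maximalIdeal L)
  (E₀ : AdicCompletion (maximalIdeal R) R ≃+* MvPowerSeries (Option (Fin n)) κ)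
  (c : Option (Fin n) → R) (hc : Ideal.span (Set.range c) = maximalIdeal R)
  (hcX : ∀ j, E₀ (algebraMap R (AdicCompletion (maximalIdeal R) R) (c j)) - X j ∈
    maximalIdeal (MvPowerSeries (Option (Fin n)) κ) ^ 2)
  (i₀ : Fin n) (e : Option (Fin n) → L) (he : ∀ j, g (c j) = g (c (some i₀)) * e j)
  (τ : Option (Fin n) → R)
  (hgen : Ideal.span (Set.range fun j : Option (Fin n) =>
    if j = some i₀ then g (c (some i₀)) else e j - g (τ j)) = maximalIdeal L)
  (hres : ∀ y : L, ∃ r : R, y - g r ∈ maximalIdeal L)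
  (hdim : (Fintype.card (Option (Fin n)) : WithBot ℕ∞) ≤ ringKrullDim L)

include hg hc he hcX hgen hres hdim in
omit [CharP κ p] in
/-- [OURS · L1 W4.6 — DICTIONARY, a `u`-CHART; replaces the role of «the closed points `ξ′ ∈ π⁻¹(ξ)` of the blowup at
which the transform has order `≥ b`» (H. Hironaka, ms. 2017, Th. 16.6 p.84 l.10) for an atom of order `≥ p + 1`: such
points lie on the hyperplane `z′ = 0` of the exceptional divisor; NOT a statement of the manuscript] **In the chart
`uᵢ` over an atom `z^p − a` with `ord a ≥ p + 1`, a point of the transform has `z`-residue `0`**: if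
`g f₀ = g(cᵢ)^p · f′` with `f′ ∈ 𝔪_L`, then `τ̃_none ∈ 𝔪_R`. [folklore] -/
theorem tau_none_mem_maximalIdeal_of_transform_mem (c₀ : (Fin n → ℕ) → κ)
    (hc₀ : ser p n κ c₀ ∈ maximalIdeal (MvPowerSeries (Fin n) κ) ^ (p + 1)) (f₀ : R)
    (w₀ : MvPowerSeries (Option (Fin n)) κ) (hw₀ : IsUnit w₀)
    (hf₀ : E₀ (algebraMap R (AdicCompletion (maximalIdeal R) R) f₀) =
      w₀ * ((X none : MvPowerSeries (Option (Fin n)) κ) ^ p - rename (some : Fin n → Option (Fin n)) (ser p n κ c₀)))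
    (f' : L) (hf' : g f₀ = g (c (some i₀)) ^ p * f') (hf'𝔪 : f' ∈ maximalIdeal L) :
    τ none ∈ maximalIdeal R := by
  -- notation
  set ĝ := adicCompletionMap (maximalIdeal R) (maximalIdeal L) g hg with hĝ
  set φ : MvPowerSeries (Option (Fin n)) κ →+* AdicCompletion (maximalIdeal L) L := ĝ.comp E₀.symm.toRingHom with hφ
  set ofL := algebraMap L (AdicCompletion (maximalIdeal L) L) with hofL
  set ofR := algebraMap R (AdicCompletion (maximalIdeal R) R) with hofR
  set t : Option (Fin n) → κ := fun j => constantCoeff (E₀ (ofR (τ j))) with ht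
  have hφE₀ : ∀ x, φ (E₀ x) = ĝ x := fun x => by
    rw [hφ, RingHom.comp_apply]
    change ĝ (E₀.symm (E₀ x)) = ĝ x
    rw [RingEquiv.symm_apply_apply]
  have hĝ_of : ∀ x : R, ĝ (ofR x) = ofL (g x) := fun x => by
    rw [hofR, hofL, hĝ, adicCompletionMap_algebraMap]
  haveI : IsNoetherianRing (AdicCompletion (maximalIdeal L) L) := isNoetherianRing_adicCompletion_maximalIdeal L
  -- suppose not: the `z`-residue `ζ = t none` is non-zero
  by_contra hτ
  have hζ0 : t none ≠ 0 := by
    have hu : IsUnit (τ none) := (IsLocalRing.notMem_maximalIdeal).mp hτ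
    have hu' : IsUnit (E₀ (ofR (τ none))) := (hu.map ofR).map E₀
    rw [MvPowerSeries.isUnit_iff_constantCoeff] at hu'
    exact hu'.ne_zero
  -- the plain chart at index `some i₀`
  obtain ⟨E, hEC, hEi, hEj⟩ :=
    exists_ringEquiv_completion_chart g hg E₀ c hc hcX (some i₀) e he τ hgen hres hdim
  set σ : Option (Fin n) → MvPowerSeries (Option (Fin n)) κ := fun j =>
    if j = some i₀ then X (some i₀) else X (some i₀) * (X j + MvPowerSeries.C (t j)) with hσ
  have hσsub : HasSubst σ := hasSubst_chart (some i₀) t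
  have hEφ : ∀ f, E (φ f) = subst σ f := by
    intro f
    refine ringHom_eq_subst_of_apply_X ((E : _ →+* MvPowerSeries (Option (Fin n)) κ).comp φ) hEC (some i₀) t hEi
      (fun j hj => ?_) f
    rw [RingHom.comp_apply]
    change E (φ (X j)) = _
    rw [hEj j hj]
  have hσi : σ (some i₀) = X (some i₀) := by rw [hσ]; simp
  have hσX : ∀ j, σ j ∈ Ideal.span {(X (some i₀) : MvPowerSeries (Option (Fin n)) κ)} := by
    intro j
    by_cases hj : j = some i₀
    · rw [hσ]; simp only [hj, if_true]; exact Ideal.subset_span rfl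
    · rw [hσ]; simp only [if_neg hj]; exact Ideal.mul_mem_right _ _ (Ideal.subset_span rfl)
  have hσnone : σ none = X (some i₀) * (X none + MvPowerSeries.C (t none)) := by
    rw [hσ]; simp
  -- `σ(a) = uᵢ^(p+1) · m` since `ord a ≥ p + 1`
  have hσa : subst σ (rename (some : Fin n → Option (Fin n)) (ser p n κ c₀)) ∈
      Ideal.span {(X (some i₀) : MvPowerSeries (Option (Fin n)) κ) ^ (p + 1)} := by
    rw [rename_some_eq_subst, subst_comp_subst_apply hasSubst_X_some hσsub]
    have hb : HasSubst (fun j : Fin n => subst σ (X (some j) : MvPowerSeries (Option (Fin n)) κ)) :=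
      hasSubst_of_constantCoeff_zero fun j => by
        rw [subst_X hσsub, hσ]
        by_cases hj : (some j : Option (Fin n)) = some i₀
        · simp [hj]
        · simp [hj]
    have h1 := subst_mem_pow_of_mem_maximalIdeal_pow hb (fun j => by rw [subst_X hσsub]; exact hσX (some j)) hc₀
    rwa [Ideal.span_singleton_pow] at h1
  obtain ⟨m, hm⟩ := Ideal.mem_span_singleton'.1 hσa
  -- `E (g f₀) = σ(w₀) · (uᵢ^p (z + ζ)^p − uᵢ^(p+1) m)`
  have hatom : subst σ ((X none : MvPowerSeries (Option (Fin n)) κ) ^ p -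
      rename (some : Fin n → Option (Fin n)) (ser p n κ c₀)) =
        X (some i₀) ^ p * ((X none + MvPowerSeries.C (t none)) ^ p - X (some i₀) * m) := by
    rw [← substAlgHom_apply hσsub, map_sub, map_pow, substAlgHom_apply, substAlgHom_apply, subst_X hσsub, hσnone,
      ← hm, mul_pow, pow_succ]
    ring
  have hEgf₀ : E (ofL (g f₀)) = subst σ w₀ * (X (some i₀) ^ p * ((X none + MvPowerSeries.C (t none)) ^ p -
      X (some i₀) * m)) := by
    rw [← hĝ_of, ← hφE₀, hf₀, map_mul, map_mul, hEφ, hEφ, hatom]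
  -- `E (g cᵢ) = uᵢ · unit`
  obtain ⟨w₁, hw₁, hEci⟩ : ∃ w₁ : MvPowerSeries (Option (Fin n)) κ, IsUnit w₁ ∧
      E (ofL (g (c (some i₀)))) = X (some i₀) * w₁ := by
    obtain ⟨w₁, hw₁, h⟩ := exists_isUnit_image_adapted' (some i₀) hσsub hσi hσX (E₀ (ofR (c (some i₀))))
      (hcX (some i₀))
    exact ⟨w₁, hw₁, by rw [← hĝ_of, ← hφE₀, hEφ, h]⟩
  -- cancel `uᵢ^p`
  have hX0 : (X (some i₀) : MvPowerSeries (Option (Fin n)) κ) ≠ 0 := X_some_ne_zero i₀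
  have hEf' : w₁ ^ p * E (ofL f') = subst σ w₀ * ((X none + MvPowerSeries.C (t none)) ^ p - X (some i₀) * m) := by
    have h1 : E (ofL (g f₀)) = (X (some i₀) * w₁) ^ p * E (ofL f') := by
      rw [hf', map_mul, map_pow, map_mul, map_pow, hEci]
    have h2 : (X (some i₀) : MvPowerSeries (Option (Fin n)) κ) ^ p * (w₁ ^ p * E (ofL f')) =
        X (some i₀) ^ p * (subst σ w₀ * ((X none + MvPowerSeries.C (t none)) ^ p - X (some i₀) * m)) := by
      rw [← mul_assoc, ← mul_pow, ← h1, hEgf₀]; ring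
    exact mul_left_cancel₀ (pow_ne_zero p hX0) h2
  -- constant terms: `0 = w₀(0) · ζ^p`
  have hf'0 : constantCoeff (E (ofL f')) = 0 := by
    refine mem_maximalIdeal_iff_constantCoeff_eq_zero.1 (ringEquiv_mem_maximalIdeal E ?_)
    rw [hofL, AdicCompletion.maximalIdeal_eq_map]
    exact Ideal.mem_map_of_mem _ hf'𝔪
  have hcc := congrArg constantCoeff hEf'
  rw [map_mul, hf'0, mul_zero, map_mul, map_sub, map_pow, map_add, constantCoeff_X, zero_add, constantCoeff_C,
    map_mul, constantCoeff_X, zero_mul, sub_zero] at hcc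
  have hw₀' : IsUnit (constantCoeff (subst σ w₀)) := by
    rw [← MvPowerSeries.isUnit_iff_constantCoeff, ← substAlgHom_apply hσsub]
    exact hw₀.map _
  have hζp : t none ^ p = 0 := (hw₀'.mul_right_eq_zero).mp hcc.symm
  exact hζ0 (pow_eq_zero_iff (Fact.out : p.Prime).ne_zero |>.mp hζp)

end UChart

end CampaignW46.AtomGerm

end Summit.ResolutionOfSingularities.ResolutionOfSingularities.Theorems

end
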